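import Summits.BirchSwinnertonDyer.BirchSwinnertonDyer.Theorems.ByReductionTypeAtTwoOrdKatoHalfAtTwoIsoZetaColemanMuIotaDoor
import HarnessLib

/-!
# Route ByReductionTypeAtTwo, crux `OrdKatoHalfAtTwoIso` (stmt-BirchSwinnertonDyer-19573), line
# `steinberg-fibre-at-two`, child F1μ⁺ `OrdKatoFineZetaAtTwoResidue` (stmt-BirchSwinnertonDyer-23959): the ∀-forms and the doors
# BY NAME from the SEMILINEAR supply «F1μ⁺ι» (Kato's zeta classes in Coleman coordinates at `2` with a `θ`-semilinear column
# map `τ : P →ₛₗ[θ] X(E/ℚ_∞)`, `θ` a FIXED ring automorphism of `Λ`) — `μ = 0`, Kato's `μ`-part, lower divisibility at `W`,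
# B8, the residue binder and the CRUX, plus monotonicity «F1μ⁺ (linear) = the case `θ = 1`»

Seat `cruxlead-stmt-BirchSwinnertonDyer-19573-w3` g2 (prover WIDTH under the LEAD `cruxlead-19573` g5; HOME
`run/shared/lean/pub/bsd-2adic/`; `--supports` stmt-BirchSwinnertonDyer-23959). HONEST FRAMING (cell bsd-2adic): BSD is not
proved by any of this; F1μ⁺, F1μ⁺ι, CoreA⁺, B7/B7′ and the crux are NOT proved here; every theorem is a KERNEL implication over
explicit hypotheses (no definition, no named fact, no `sorry`). Sequel of `…ZetaColemanMuIotaDoor.lean` (the finding: for the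
tree's `SelmerDualData` convention Kato's Poitou–Tate column map is `ι`-semilinear, so the honest F1 reading has
`τ : P →ₛₗ[ι] D.X`; per-datum `μ = 0` for a `θ`-semilinear `τ` is proved there).

* §1 for a FIXED ring automorphism `θ` of `Λ` (print: `θ = ι = IwasawaAlgebra.involEquiv 2`; filed: `θ = 1`), the
  `θ`-SEMILINEAR supply `hZθ` («F1μ⁺θ» = the body of `ZetaColemanMuInputsAtTwo` with `τ : P →ₛₗ[θ] D.X`; a hypothesis, NOT a
  definition) on the sign-free habitat «good ordinary at `2`, `ρ̄₂` onto» together with CoreA⁺ BY NAME gives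
  `mu_eq_zero_of_zetaColemanMuTheta`, `katoMuPartAtTwo_of_zetaColemanMuTheta`,
  `mainConjectureLowerDivisibilityAtTwoOrd_of_zetaColemanMuTheta` (w2's p682426 / lead's p684479 chain re-threaded);
* §2 BY NAME: `katoIntAtGoodOrdSurjectiveTwo_of_zetaColemanMuTheta` (B8 DERIVED), `ordKatoHalfDD12ResidueTwo_of_…`,
  `ordKatoHalfAtTwoIso_of_zetaColemanMuTheta` (the CRUX from F1μ⁺θ + CoreA⁺ + Abbes–Ullmo + B7 + 17.4 (1)(2)) and
  `ordKatoHalfAtTwoIso_of_zetaColemanMuTheta_cite` (the split glue's shape: bundle `PUB ∧ AU ∧ 5.14@2`, B7′, CoreA⁺);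
* §3 monotonicity `zetaColemanMuTheta_refl_of_zetaColemanMuInputsAtTwo`: F1μ⁺ ⇒ F1μ⁺θ at `θ = 1`, and the sanity check
  `ordKatoHalfAtTwoIso_of_zetaColemanMuTheta_refl` (the filed child still closes the crux through the `θ`-chain). So
  re-cutting the F1 child to the `ι`-aware text «F1μ⁺ι» (= `hZθ` at `θ = ι`) loses nothing already filed.

References: [Kato2004Asterisque] Thm 12.6 (p. 222), (14.9.3) (p. 240), Thm 16.6 (p. 271), Thm 17.4 (1)(2) (p. 273), Prop 17.11
(p. 277), §17.13 (pp. 279–280); [GreenbergLNM1716] §1 p. 60, Conj. 1.11, Prop. 5.14; [AbbesUllmo1996] Thm A; [Washington1997]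
§13.2; tree p654400, p669276, p678187, p679274, p682426, p684479, `…ZetaColemanMuIotaDoor` (w3 g2), HOME RC-373 (1).
-/

set_option autoImplicit false
set_option linter.dupNamespace false

noncomputable section

open scoped Classical MatrixGroups ModularForm NumberField
open CongruenceSubgroup WeierstrassCurve Field IsDedekindDomain NumberField
open Literature.NumberTheory.GaloisRepresentations
open Literature.NumberTheory.GaloisCohomology
open Literature.NumberTheory.EllipticCurves Literature.NumberTheory.EllipticCurves.ModularForms
open Literature.NumberTheory.EllipticCurves.Kato2004
  Literature.NumberTheory.EllipticCurves.Kato2004.EulerSystemValues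
open Literature.NumberTheory.EllipticCurves.Rank1Residual
open Literature.NumberTheory.EllipticCurves.Greenberg1999
open Summit.BirchSwinnertonDyer.BirchSwinnertonDyer.Theorems.Rank1ResidualX1Defs
  Summit.BirchSwinnertonDyer.BirchSwinnertonDyer.Rank1Residual
  Summit.BirchSwinnertonDyer.BirchSwinnertonDyer.Rank1Residual.CoreAssembly
open Summit.BirchSwinnertonDyer.Rank1Residual Summit.BirchSwinnertonDyer.Rank1Residual.X5
open Summit.BirchSwinnertonDyer.BirchSwinnertonDyer.Theorems.OrdKatoOptimalAtTwo
  Summit.BirchSwinnertonDyer.BirchSwinnertonDyer.Theorems.OrdKatoIntAtTwo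
open Summit.BirchSwinnertonDyer.BirchSwinnertonDyer.Theses.ByReductionTypeAtTwo

namespace Summit.BirchSwinnertonDyer.BirchSwinnertonDyer.Theorems.SteinbergFibreAtTwo

/-! ## §1 The ∀-forms from the θ-SEMILINEAR supply «F1μ⁺θ» (θ fixed; ι in print) on the sign-free habitat -/

section Habitat

/- In every door below, `hZθ` is the `θ`-SEMILINEAR supply «F1μ⁺θ» for a FIXED ring automorphism `θ` of `Λ`: the body
of `ZetaColemanMuInputsAtTwo` (child 23959) with `τ : P →ₛₗ[θ] D.X` in place of the `Λ`-linear `τ` (print: `θ = ι`; filed: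
`θ = 1`, §3). A hypothesis, not a definition. -/

/-- **`μ(X(E/ℚ_∞)) = 0` for every cyclotomic Selmer dual datum on the SIGN-FREE habitat «good ordinary at `2`, `ρ̄₂` onto»,
modulo the semilinear supply F1μ⁺ι and CoreA⁺** (structure facts of `T₂W` and the fine datum from tree theorems).
[cite: Kato2004Asterisque, §17.13 (pp. 279–280)] [cite: GreenbergLNM1716, Conj. 1.11 (p. 64) (shape)] -/
theorem mu_eq_zero_of_zetaColemanMuTheta (θ : IwasawaAlgebra 2 ≃+* IwasawaAlgebra 2)
    (hZθ : ∀ (W : WeierstrassCurve ℚ) [W.IsElliptic] [W.IsGloballyMinimal]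
      [ContinuousSMul ℤ_[2] (W.tateModule 2)] [Module.Free ℤ_[2] (W.tateModule 2)]
      [Module.Finite ℤ_[2] (W.tateModule 2)] {N : ℕ} [NeZero N] (f : CuspForm (Gamma0 N) 2)
      (κ : ZpExtension ℚ 2) (γ : absoluteGaloisGroup ℚ) (hκ : κ.IsCyclotomic),
      IsOrdinaryAt W 2 → W.HasSurjectiveModNGaloisRep 2 →
      κ.IsTopGenerator γ → IsCyclotomicVariable 2 γ → IsNewformOf W f →
      ∀ (D : W.SelmerDualData κ γ) (Y : W.FineSelmerDualData κ γ),
        ∃ (I : IwasawaH1Data W 2 κ γ)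
          (Z : Submodule (IwasawaAlgebra 2) I.H) (P : Submodule (IwasawaAlgebra 2) (IwasawaAlgebra 2))
          (ℓ : I.H →ₗ[IwasawaAlgebra 2] P) (τ : P →ₛₗ[(θ : IwasawaAlgebra 2 →+* IwasawaAlgebra 2)] D.X)
          (π : D.X →ₗ[IwasawaAlgebra 2] Y.X),
          Z ≤ Submodule.span (IwasawaAlgebra 2) {s : I.H | IsEulerSystemClassTwo W hκ I s} ∧
          (∀ z ∈ Z, τ (ℓ z) = 0) ∧ Function.Surjective π ∧ Function.Exact τ π ∧
          ∀ G₁ : IwasawaAlgebra 2,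
            iwasawaToPowerSeries 2 G₁ = padicLFunction f (unitRoot W 2 : ℚ_[2]) →
              ∃ s : IwasawaAlgebra 2, s ∉ IwasawaAlgebra.augIdealP 2 ∧
                s * G₁ ∈ Submodule.map (P.subtype ∘ₗ ℓ) Z)
    (hpos : CoreTheoremAPosDiscTwo) (W : WeierstrassCurve ℚ) [W.IsElliptic] [W.IsGloballyMinimal]
    (hgo : GoodOrd W 2) (h2 : W.HasSurjectiveModNGaloisRep 2)
    {N : ℕ} [NeZero N] (f : CuspForm (Gamma0 N) 2) (hf : IsNewformOf W f)
    (κ : ZpExtension ℚ 2) (γ : absoluteGaloisGroup ℚ) (hκ : κ.IsCyclotomic) (hγ : κ.IsTopGenerator γ)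
    (hγ' : IsCyclotomicVariable 2 γ) (D : W.SelmerDualData κ γ) : D.mu = 0 := by
  haveI : ContinuousSMul ℤ_[2] (W.tateModule 2) := TateModule.continuousSMul_padicInt
  haveI : Module.Free ℤ_[2] (W.tateModule 2) := W.module_free_tateModule_holds 2
  haveI : Module.Finite ℤ_[2] (W.tateModule 2) := W.module_finite_tateModule_holds 2
  obtain ⟨Y⟩ := W.nonempty_fineSelmerDualData κ hγ
  obtain ⟨I, Z, P, ℓ, τ, π, hZ, hτℓ, hπs, hπ, himg⟩ := hZθ W f κ γ hκ ⟨hgo.1, hgo.2⟩ h2 hγ hγ' hf D Y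
  exact mu_eq_zero_of_zetaColemanMuIota_of_coreTheoremAPosDiscTwo hpos hgo h2 hf hγ θ I Z P ℓ τ π hZ hτℓ hπs hπ
    himg

/-- **Kato's `μ`-part `O1.KatoMuPartAtTwo W` on the sign-free habitat, modulo F1μ⁺ι and CoreA⁺** (`μ = 0 ⇒ 2^μ = 1 ∣ L₀`).
[cite: GreenbergLNM1716, Conj. 1.11 (p. 64) (shape)] -/
theorem katoMuPartAtTwo_of_zetaColemanMuTheta (θ : IwasawaAlgebra 2 ≃+* IwasawaAlgebra 2)
    (hZθ : ∀ (W : WeierstrassCurve ℚ) [W.IsElliptic] [W.IsGloballyMinimal]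
      [ContinuousSMul ℤ_[2] (W.tateModule 2)] [Module.Free ℤ_[2] (W.tateModule 2)]
      [Module.Finite ℤ_[2] (W.tateModule 2)] {N : ℕ} [NeZero N] (f : CuspForm (Gamma0 N) 2)
      (κ : ZpExtension ℚ 2) (γ : absoluteGaloisGroup ℚ) (hκ : κ.IsCyclotomic),
      IsOrdinaryAt W 2 → W.HasSurjectiveModNGaloisRep 2 →
      κ.IsTopGenerator γ → IsCyclotomicVariable 2 γ → IsNewformOf W f →
      ∀ (D : W.SelmerDualData κ γ) (Y : W.FineSelmerDualData κ γ),
        ∃ (I : IwasawaH1Data W 2 κ γ)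
          (Z : Submodule (IwasawaAlgebra 2) I.H) (P : Submodule (IwasawaAlgebra 2) (IwasawaAlgebra 2))
          (ℓ : I.H →ₗ[IwasawaAlgebra 2] P) (τ : P →ₛₗ[(θ : IwasawaAlgebra 2 →+* IwasawaAlgebra 2)] D.X)
          (π : D.X →ₗ[IwasawaAlgebra 2] Y.X),
          Z ≤ Submodule.span (IwasawaAlgebra 2) {s : I.H | IsEulerSystemClassTwo W hκ I s} ∧
          (∀ z ∈ Z, τ (ℓ z) = 0) ∧ Function.Surjective π ∧ Function.Exact τ π ∧
          ∀ G₁ : IwasawaAlgebra 2,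
            iwasawaToPowerSeries 2 G₁ = padicLFunction f (unitRoot W 2 : ℚ_[2]) →
              ∃ s : IwasawaAlgebra 2, s ∉ IwasawaAlgebra.augIdealP 2 ∧
                s * G₁ ∈ Submodule.map (P.subtype ∘ₗ ℓ) Z)
    (hpos : CoreTheoremAPosDiscTwo) (W : WeierstrassCurve ℚ) [W.IsElliptic] [W.IsGloballyMinimal]
    (hgo : GoodOrd W 2) (h2 : W.HasSurjectiveModNGaloisRep 2) :
    O1.KatoMuPartAtTwo W := by
  intro κ γ hκ hγ hγ' _ _ f hf ϖ _ D L₀ _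
  rw [mu_eq_zero_of_zetaColemanMuTheta θ hZθ hpos W hgo h2 f hf κ γ hκ hγ hγ' D, pow_zero, map_one]
  exact one_dvd _

/-- **Kato's lower divisibility `X5.O1.MainConjectureLowerDivisibilityAtTwoOrd W` AT the curve on the sign-free habitat, modulo
F1μ⁺ι, CoreA⁺, Abbes–Ullmo BY NAME (`ord₂ ϖ = 0` on the `E[2]`-irreducible good locus, p654400) and Kato 17.4 (1)(2) at `2`
for `W` (`h17`, PRINT)** — through `O1.mainConjectureLowerDivisibilityAtTwoOrd_of_katoMuPartAtTwo`.
[cite: Kato2004Asterisque, Thm. 17.4 (1)(2) (p. 273)] [cite: AbbesUllmo1996, Thm. A] -/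
theorem mainConjectureLowerDivisibilityAtTwoOrd_of_zetaColemanMuTheta
    (θ : IwasawaAlgebra 2 ≃+* IwasawaAlgebra 2)
    (hZθ : ∀ (W : WeierstrassCurve ℚ) [W.IsElliptic] [W.IsGloballyMinimal]
      [ContinuousSMul ℤ_[2] (W.tateModule 2)] [Module.Free ℤ_[2] (W.tateModule 2)]
      [Module.Finite ℤ_[2] (W.tateModule 2)] {N : ℕ} [NeZero N] (f : CuspForm (Gamma0 N) 2)
      (κ : ZpExtension ℚ 2) (γ : absoluteGaloisGroup ℚ) (hκ : κ.IsCyclotomic),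
      IsOrdinaryAt W 2 → W.HasSurjectiveModNGaloisRep 2 →
      κ.IsTopGenerator γ → IsCyclotomicVariable 2 γ → IsNewformOf W f →
      ∀ (D : W.SelmerDualData κ γ) (Y : W.FineSelmerDualData κ γ),
        ∃ (I : IwasawaH1Data W 2 κ γ)
          (Z : Submodule (IwasawaAlgebra 2) I.H) (P : Submodule (IwasawaAlgebra 2) (IwasawaAlgebra 2))
          (ℓ : I.H →ₗ[IwasawaAlgebra 2] P) (τ : P →ₛₗ[(θ : IwasawaAlgebra 2 →+* IwasawaAlgebra 2)] D.X)
          (π : D.X →ₗ[IwasawaAlgebra 2] Y.X),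
          Z ≤ Submodule.span (IwasawaAlgebra 2) {s : I.H | IsEulerSystemClassTwo W hκ I s} ∧
          (∀ z ∈ Z, τ (ℓ z) = 0) ∧ Function.Surjective π ∧ Function.Exact τ π ∧
          ∀ G₁ : IwasawaAlgebra 2,
            iwasawaToPowerSeries 2 G₁ = padicLFunction f (unitRoot W 2 : ℚ_[2]) →
              ∃ s : IwasawaAlgebra 2, s ∉ IwasawaAlgebra.augIdealP 2 ∧
                s * G₁ ∈ Submodule.map (P.subtype ∘ₗ ℓ) Z)
    (hpos : CoreTheoremAPosDiscTwo) (W : WeierstrassCurve ℚ) [W.IsElliptic] [W.IsGloballyMinimal]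
    (hAU : abbesUllmo_not_dvd_maninConstant_of_not_dvd_level)
    (hgo : GoodOrd W 2) (h2 : W.HasSurjectiveModNGaloisRep 2)
    (h17 : ∀ [NeZero (W.conductorNorm ℤ)] (f : CuspForm (Gamma0 (W.conductorNorm ℤ)) 2),
      kato_divisibility_allPrimes W 2 (f := f)) :
    O1.MainConjectureLowerDivisibilityAtTwoOrd W := by
  haveI : NeZero ((2 : ℕ) : ℚ) := ⟨by norm_num⟩
  exact O1.mainConjectureLowerDivisibilityAtTwoOrd_of_katoMuPartAtTwo W h17
    (fun f hf ϖ hϖ => hint_two_of_abbesUllmo_of_irr hAU W hgo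
      (hasIrreducibleModPGaloisRep_of_hasSurjectiveModNGaloisRep W 2 h2) f hf ϖ hϖ)
    (katoMuPartAtTwo_of_zetaColemanMuTheta θ hZθ hpos W hgo h2)

end Habitat

/-! ## §2 The doors BY NAME: B8, the residue binder, the crux -/

section ByName

/-- **B8 = `KatoIntAtGoodOrdSurjectiveTwo` BY NAME from F1μ⁺ι + CoreA⁺**, Abbes–Ullmo BY NAME and Kato 17.4 (1)(2) at `2` — on
`ρ_{W,2^∞}` onto, `ρ̄₂` is onto (`n = 1`). CONDITIONAL; B8 is not proved. [cite: Kato2004Asterisque, Thm. 17.4 (1)(2) (p. 273)]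
[cite: AbbesUllmo1996, Thm. A] -/
theorem katoIntAtGoodOrdSurjectiveTwo_of_zetaColemanMuTheta
    (θ : IwasawaAlgebra 2 ≃+* IwasawaAlgebra 2)
    (hZθ : ∀ (W : WeierstrassCurve ℚ) [W.IsElliptic] [W.IsGloballyMinimal]
      [ContinuousSMul ℤ_[2] (W.tateModule 2)] [Module.Free ℤ_[2] (W.tateModule 2)]
      [Module.Finite ℤ_[2] (W.tateModule 2)] {N : ℕ} [NeZero N] (f : CuspForm (Gamma0 N) 2)
      (κ : ZpExtension ℚ 2) (γ : absoluteGaloisGroup ℚ) (hκ : κ.IsCyclotomic),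
      IsOrdinaryAt W 2 → W.HasSurjectiveModNGaloisRep 2 →
      κ.IsTopGenerator γ → IsCyclotomicVariable 2 γ → IsNewformOf W f →
      ∀ (D : W.SelmerDualData κ γ) (Y : W.FineSelmerDualData κ γ),
        ∃ (I : IwasawaH1Data W 2 κ γ)
          (Z : Submodule (IwasawaAlgebra 2) I.H) (P : Submodule (IwasawaAlgebra 2) (IwasawaAlgebra 2))
          (ℓ : I.H →ₗ[IwasawaAlgebra 2] P) (τ : P →ₛₗ[(θ : IwasawaAlgebra 2 →+* IwasawaAlgebra 2)] D.X)
          (π : D.X →ₗ[IwasawaAlgebra 2] Y.X),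
          Z ≤ Submodule.span (IwasawaAlgebra 2) {s : I.H | IsEulerSystemClassTwo W hκ I s} ∧
          (∀ z ∈ Z, τ (ℓ z) = 0) ∧ Function.Surjective π ∧ Function.Exact τ π ∧
          ∀ G₁ : IwasawaAlgebra 2,
            iwasawaToPowerSeries 2 G₁ = padicLFunction f (unitRoot W 2 : ℚ_[2]) →
              ∃ s : IwasawaAlgebra 2, s ∉ IwasawaAlgebra.augIdealP 2 ∧
                s * G₁ ∈ Submodule.map (P.subtype ∘ₗ ℓ) Z)
    (hpos : CoreTheoremAPosDiscTwo)
    (hAU : abbesUllmo_not_dvd_maninConstant_of_not_dvd_level)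
    (h17 : ∀ (V : WeierstrassCurve ℚ) [V.IsElliptic] [V.IsGloballyMinimal] [NeZero (V.conductorNorm ℤ)]
      (f : CuspForm (Gamma0 (V.conductorNorm ℤ)) 2), kato_divisibility_allPrimes V 2 (f := f)) :
    KatoIntAtGoodOrdSurjectiveTwo := by
  intro W _ _ hgo him
  have h2 : W.HasSurjectiveModNGaloisRep 2 := by
    have h := him 1 one_pos
    rwa [pow_one] at h
  exact mainConjectureLowerDivisibilityAtTwoOrd_of_zetaColemanMuTheta θ hZθ hpos W hAU hgo h2 (h17 W)

/-- **The residue binder `OrdKatoHalfDD12ResidueTwo` from F1μ⁺ι + CoreA⁺**, Abbes–Ullmo BY NAME and Kato 17.4 (1)(2) at `2`.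
[cite: Kato2004Asterisque, Thm. 17.4 (1)(2) (p. 273)] [cite: AbbesUllmo1996, Thm. A] -/
theorem ordKatoHalfDD12ResidueTwo_of_zetaColemanMuTheta
    (θ : IwasawaAlgebra 2 ≃+* IwasawaAlgebra 2)
    (hZθ : ∀ (W : WeierstrassCurve ℚ) [W.IsElliptic] [W.IsGloballyMinimal]
      [ContinuousSMul ℤ_[2] (W.tateModule 2)] [Module.Free ℤ_[2] (W.tateModule 2)]
      [Module.Finite ℤ_[2] (W.tateModule 2)] {N : ℕ} [NeZero N] (f : CuspForm (Gamma0 N) 2)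
      (κ : ZpExtension ℚ 2) (γ : absoluteGaloisGroup ℚ) (hκ : κ.IsCyclotomic),
      IsOrdinaryAt W 2 → W.HasSurjectiveModNGaloisRep 2 →
      κ.IsTopGenerator γ → IsCyclotomicVariable 2 γ → IsNewformOf W f →
      ∀ (D : W.SelmerDualData κ γ) (Y : W.FineSelmerDualData κ γ),
        ∃ (I : IwasawaH1Data W 2 κ γ)
          (Z : Submodule (IwasawaAlgebra 2) I.H) (P : Submodule (IwasawaAlgebra 2) (IwasawaAlgebra 2))
          (ℓ : I.H →ₗ[IwasawaAlgebra 2] P) (τ : P →ₛₗ[(θ : IwasawaAlgebra 2 →+* IwasawaAlgebra 2)] D.X)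
          (π : D.X →ₗ[IwasawaAlgebra 2] Y.X),
          Z ≤ Submodule.span (IwasawaAlgebra 2) {s : I.H | IsEulerSystemClassTwo W hκ I s} ∧
          (∀ z ∈ Z, τ (ℓ z) = 0) ∧ Function.Surjective π ∧ Function.Exact τ π ∧
          ∀ G₁ : IwasawaAlgebra 2,
            iwasawaToPowerSeries 2 G₁ = padicLFunction f (unitRoot W 2 : ℚ_[2]) →
              ∃ s : IwasawaAlgebra 2, s ∉ IwasawaAlgebra.augIdealP 2 ∧
                s * G₁ ∈ Submodule.map (P.subtype ∘ₗ ℓ) Z)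
    (hpos : CoreTheoremAPosDiscTwo)
    (hAU : abbesUllmo_not_dvd_maninConstant_of_not_dvd_level)
    (h17 : ∀ (V : WeierstrassCurve ℚ) [V.IsElliptic] [V.IsGloballyMinimal] [NeZero (V.conductorNorm ℤ)]
      (f : CuspForm (Gamma0 (V.conductorNorm ℤ)) 2), kato_divisibility_allPrimes V 2 (f := f)) :
    OrdKatoHalfDD12ResidueTwo := by
  intro W _ _ _ hgo h2 _
  exact mainConjectureLowerDivisibilityAtTwoOrd_of_zetaColemanMuTheta θ hZθ hpos W hAU hgo h2 (h17 W)

/-- **The crux `OrdKatoHalfAtTwoIso` (stmt-BirchSwinnertonDyer-19573) BY NAME from F1μ⁺ι (semilinear column map) + CoreA⁺ +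
Abbes–Ullmo + B7 + Kato 17.4 (1)(2) at `2`** — one application of the cell's door `ordKatoHalfAtTwoIso_of_binders` with B8 DERIVED.
CONDITIONAL on the displayed hypotheses; nothing closed. [cite: Kato2004Asterisque, Thm. 17.4 (1)(2) (p. 273)] [cite: AbbesUllmo1996, Thm. A] -/
theorem ordKatoHalfAtTwoIso_of_zetaColemanMuTheta
    (θ : IwasawaAlgebra 2 ≃+* IwasawaAlgebra 2)
    (hZθ : ∀ (W : WeierstrassCurve ℚ) [W.IsElliptic] [W.IsGloballyMinimal]
      [ContinuousSMul ℤ_[2] (W.tateModule 2)] [Module.Free ℤ_[2] (W.tateModule 2)]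
      [Module.Finite ℤ_[2] (W.tateModule 2)] {N : ℕ} [NeZero N] (f : CuspForm (Gamma0 N) 2)
      (κ : ZpExtension ℚ 2) (γ : absoluteGaloisGroup ℚ) (hκ : κ.IsCyclotomic),
      IsOrdinaryAt W 2 → W.HasSurjectiveModNGaloisRep 2 →
      κ.IsTopGenerator γ → IsCyclotomicVariable 2 γ → IsNewformOf W f →
      ∀ (D : W.SelmerDualData κ γ) (Y : W.FineSelmerDualData κ γ),
        ∃ (I : IwasawaH1Data W 2 κ γ)
          (Z : Submodule (IwasawaAlgebra 2) I.H) (P : Submodule (IwasawaAlgebra 2) (IwasawaAlgebra 2))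
          (ℓ : I.H →ₗ[IwasawaAlgebra 2] P) (τ : P →ₛₗ[(θ : IwasawaAlgebra 2 →+* IwasawaAlgebra 2)] D.X)
          (π : D.X →ₗ[IwasawaAlgebra 2] Y.X),
          Z ≤ Submodule.span (IwasawaAlgebra 2) {s : I.H | IsEulerSystemClassTwo W hκ I s} ∧
          (∀ z ∈ Z, τ (ℓ z) = 0) ∧ Function.Surjective π ∧ Function.Exact τ π ∧
          ∀ G₁ : IwasawaAlgebra 2,
            iwasawaToPowerSeries 2 G₁ = padicLFunction f (unitRoot W 2 : ℚ_[2]) →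
              ∃ s : IwasawaAlgebra 2, s ∉ IwasawaAlgebra.augIdealP 2 ∧
                s * G₁ ∈ Submodule.map (P.subtype ∘ₗ ℓ) Z)
    (hpos : CoreTheoremAPosDiscTwo)
    (hAU : abbesUllmo_not_dvd_maninConstant_of_not_dvd_level) (hB7 : KatoMuPartAtOptimalMemberOfNotSurjectiveTwo)
    (h17 : ∀ (V : WeierstrassCurve ℚ) [V.IsElliptic] [V.IsGloballyMinimal] [NeZero (V.conductorNorm ℤ)]
      (f : CuspForm (Gamma0 (V.conductorNorm ℤ)) 2), kato_divisibility_allPrimes V 2 (f := f)) :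
    OrdKatoHalfAtTwoIso :=
  ordKatoHalfAtTwoIso_of_binders hB7 (katoIntAtGoodOrdSurjectiveTwo_of_zetaColemanMuTheta θ hZθ hpos hAU h17)
    (ordKatoHalfDD12ResidueTwo_of_zetaColemanMuTheta θ hZθ hpos hAU h17) h17

/-- **The crux BY NAME in the split glue's shape** — bundle `PUB ∧ AU ∧ 5.14@2` (child 23889), F1 slot := the SEMILINEAR supply
F1μ⁺ι, B7 slot := the re-cut B7′ (`KatoMuPartOff514AtOptimalMemberOfNotSurjectiveTwo`, child 23921), B8 slot := CoreA⁺ — via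
the lead's `ordKatoHalfAtTwoIso_of_signFree_cite` pattern: B7′ + Prop. 5.14@2 give the filed B7
(`katoMuPartAtOptimalMember_of_prop514_of_off514`). CONDITIONAL; nothing closed.
[cite: Kato2004Asterisque, Thm. 17.4 (1)(2) (p. 273)] [cite: GreenbergLNM1716, Prop. 5.14 (p. 130)] [cite: AbbesUllmo1996, Thm. A] -/
theorem ordKatoHalfAtTwoIso_of_zetaColemanMuTheta_cite
    (θ : IwasawaAlgebra 2 ≃+* IwasawaAlgebra 2)
    (hZθ : ∀ (W : WeierstrassCurve ℚ) [W.IsElliptic] [W.IsGloballyMinimal]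
      [ContinuousSMul ℤ_[2] (W.tateModule 2)] [Module.Free ℤ_[2] (W.tateModule 2)]
      [Module.Finite ℤ_[2] (W.tateModule 2)] {N : ℕ} [NeZero N] (f : CuspForm (Gamma0 N) 2)
      (κ : ZpExtension ℚ 2) (γ : absoluteGaloisGroup ℚ) (hκ : κ.IsCyclotomic),
      IsOrdinaryAt W 2 → W.HasSurjectiveModNGaloisRep 2 →
      κ.IsTopGenerator γ → IsCyclotomicVariable 2 γ → IsNewformOf W f →
      ∀ (D : W.SelmerDualData κ γ) (Y : W.FineSelmerDualData κ γ),
        ∃ (I : IwasawaH1Data W 2 κ γ)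
          (Z : Submodule (IwasawaAlgebra 2) I.H) (P : Submodule (IwasawaAlgebra 2) (IwasawaAlgebra 2))
          (ℓ : I.H →ₗ[IwasawaAlgebra 2] P) (τ : P →ₛₗ[(θ : IwasawaAlgebra 2 →+* IwasawaAlgebra 2)] D.X)
          (π : D.X →ₗ[IwasawaAlgebra 2] Y.X),
          Z ≤ Submodule.span (IwasawaAlgebra 2) {s : I.H | IsEulerSystemClassTwo W hκ I s} ∧
          (∀ z ∈ Z, τ (ℓ z) = 0) ∧ Function.Surjective π ∧ Function.Exact τ π ∧
          ∀ G₁ : IwasawaAlgebra 2,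
            iwasawaToPowerSeries 2 G₁ = padicLFunction f (unitRoot W 2 : ℚ_[2]) →
              ∃ s : IwasawaAlgebra 2, s ∉ IwasawaAlgebra.augIdealP 2 ∧
                s * G₁ ∈ Submodule.map (P.subtype ∘ₗ ℓ) Z)
    (hpos : CoreTheoremAPosDiscTwo)
    (hbundle : OrdPublishedInputsAtTwo ∧ abbesUllmo_not_dvd_maninConstant_of_not_dvd_level ∧
      Greenberg1999.prop514_isTorsion_mu_eq_zero_two)
    (hB7' : KatoMuPartOff514AtOptimalMemberOfNotSurjectiveTwo) : OrdKatoHalfAtTwoIso := by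
  obtain ⟨hPub, hAU, h514⟩ := hbundle
  obtain ⟨_, _, h17, _⟩ := hPub
  exact ordKatoHalfAtTwoIso_of_zetaColemanMuTheta θ hZθ hpos hAU
    (katoMuPartAtOptimalMember_of_prop514_of_off514 h514 hB7') h17

end ByName

/-! ## §3 Monotonicity: the filed F1μ⁺ (linear `τ`) is the case `θ = 1` -/

/-- **F1μ⁺ ⇒ F1μ⁺θ at `θ = 1`**: the filed reading `ZetaColemanMuInputsAtTwo` (linear `τ`) is the supply `hZθ` of §1 for
`θ = RingEquiv.refl Λ` (so every door of §§1–2 applies to the filed child 23959 as it stands). [folklore] -/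
theorem zetaColemanMuTheta_refl_of_zetaColemanMuInputsAtTwo (hZ : ZetaColemanMuInputsAtTwo) :
    ∀ (W : WeierstrassCurve ℚ) [W.IsElliptic] [W.IsGloballyMinimal]
      [ContinuousSMul ℤ_[2] (W.tateModule 2)] [Module.Free ℤ_[2] (W.tateModule 2)]
      [Module.Finite ℤ_[2] (W.tateModule 2)] {N : ℕ} [NeZero N] (f : CuspForm (Gamma0 N) 2)
      (κ : ZpExtension ℚ 2) (γ : absoluteGaloisGroup ℚ) (hκ : κ.IsCyclotomic),
      IsOrdinaryAt W 2 → W.HasSurjectiveModNGaloisRep 2 →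
      κ.IsTopGenerator γ → IsCyclotomicVariable 2 γ → IsNewformOf W f →
      ∀ (D : W.SelmerDualData κ γ) (Y : W.FineSelmerDualData κ γ),
        ∃ (I : IwasawaH1Data W 2 κ γ)
          (Z : Submodule (IwasawaAlgebra 2) I.H) (P : Submodule (IwasawaAlgebra 2) (IwasawaAlgebra 2))
          (ℓ : I.H →ₗ[IwasawaAlgebra 2] P)
          (τ : P →ₛₗ[((RingEquiv.refl (IwasawaAlgebra 2) : IwasawaAlgebra 2 ≃+* IwasawaAlgebra 2) :
            IwasawaAlgebra 2 →+* IwasawaAlgebra 2)] D.X)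
          (π : D.X →ₗ[IwasawaAlgebra 2] Y.X),
          Z ≤ Submodule.span (IwasawaAlgebra 2) {s : I.H | IsEulerSystemClassTwo W hκ I s} ∧
          (∀ z ∈ Z, τ (ℓ z) = 0) ∧ Function.Surjective π ∧ Function.Exact τ π ∧
          ∀ G₁ : IwasawaAlgebra 2,
            iwasawaToPowerSeries 2 G₁ = padicLFunction f (unitRoot W 2 : ℚ_[2]) →
              ∃ s : IwasawaAlgebra 2, s ∉ IwasawaAlgebra.augIdealP 2 ∧
                s * G₁ ∈ Submodule.map (P.subtype ∘ₗ ℓ) Z := by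
  intro W _ _ _ _ _ N _ f κ γ hκ hord h2 hγ hγ' hf D Y
  obtain ⟨I, Z, P, ℓ, τ, π, hZ, hτℓ, hπs, hπ, himg⟩ := hZ W f κ γ hκ hord h2 hγ hγ' hf D Y
  let τ' : P →ₛₗ[((RingEquiv.refl (IwasawaAlgebra 2) : IwasawaAlgebra 2 ≃+* IwasawaAlgebra 2) :
      IwasawaAlgebra 2 →+* IwasawaAlgebra 2)] D.X :=
    { toFun := τ
      map_add' := τ.map_add
      map_smul' := fun r x => by rw [τ.map_smul]; rfl }
  exact ⟨I, Z, P, ℓ, τ', π, hZ, hτℓ, hπs, hπ, himg⟩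

/-- **The crux BY NAME from the filed F1μ⁺ through the `θ`-door at `θ = 1`** (sanity check that the semilinear chain
specialises to the lead's `ordKatoHalfAtTwoIso_of_signFree`; CONDITIONAL, nothing closed).
[cite: Kato2004Asterisque, Thm. 17.4 (1)(2) (p. 273)] [cite: AbbesUllmo1996, Thm. A] -/
theorem ordKatoHalfAtTwoIso_of_zetaColemanMuTheta_refl (hZ : ZetaColemanMuInputsAtTwo) (hpos : CoreTheoremAPosDiscTwo)
    (hAU : abbesUllmo_not_dvd_maninConstant_of_not_dvd_level) (hB7 : KatoMuPartAtOptimalMemberOfNotSurjectiveTwo)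
    (h17 : ∀ (V : WeierstrassCurve ℚ) [V.IsElliptic] [V.IsGloballyMinimal] [NeZero (V.conductorNorm ℤ)]
      (f : CuspForm (Gamma0 (V.conductorNorm ℤ)) 2), kato_divisibility_allPrimes V 2 (f := f)) :
    OrdKatoHalfAtTwoIso :=
  ordKatoHalfAtTwoIso_of_zetaColemanMuTheta (RingEquiv.refl _)
    (zetaColemanMuTheta_refl_of_zetaColemanMuInputsAtTwo hZ) hpos hAU hB7 h17

end Summit.BirchSwinnertonDyer.BirchSwinnertonDyer.Theorems.SteinbergFibreAtTwo

end
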